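import Summits.KontsevichZagierPeriods.KontsevichZagierPeriods.Theorems.HurwitzMicroSectorsNormalFormPrincipleM2MoebiusKit
import Literature.NumberTheory.Transcendental.EllIterRep

/-!
# `NormalFormPrinciple` (stmt-KontsevichZagierPeriods-3869), line `SketchIdeator1` — leaf `stub_boxRigidity`,
# dimension two off the product type (`CatalanTwoWays`, half-angle/Möbius/Catalan side): the half-angle base change

Registered sub-goal `halfAngle_baseChange` of the layer `CatalanTwoWays` (lead file `…CatalanArc`).
Notation: `t₈ = √2 − 1 = tan(π/8)`, `c₁(s) = (1 − s t₈)/(s + t₈)`, `c₂(s) = (1 + t₈ s)/(t₈ − s)`,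
`x(s) = 2√2 s/(1 + s²)` (`= √2 sin θ` for `s = tan(θ/2)`), `V(x) = (√(2−x²)+1)/(√(2−x²)−1)`.
For any integral representation `Ms` with domain the band `{0 < s < t₈, 1 ≤ t ≤ c₁(s) c₂(s)}`
and integrand `(1/(1+s²))/t` on it, and any `J` with domain `{0 < x < 1, 1 ≤ t ≤ V(x)}` and
integrand `(1/(2√(2−x²)))/t` on it, `[Ms] − [J] ∈ relations` by ONE change of variables
(Kontsevich–Zagier rule (2)) along `(s, t) ↦ (x(s), t)`: the lift
`KZ.of_sub_of_mem_relations_covLift` of the base change `x = x(s)`, which is `ℚ`-semialgebraic on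
`(0, t₈)` (`√2` and `t₈` are algebraic, so the base `(0, t₈)` is `ℚ`-semialgebraic), differentiable
with `x'(s) = 2√2 (1−s²)/(1+s²)²`, injective on `(0, t₈)` with image `(0, 1)` (inverse
`s = x/(√2 + √(2−x²))`), and carries the edge `c₁ c₂` to `V` (`√(2 − x(s)²) = √2 (1−s²)/(1+s²)`
and the Möbius factorisation, both from `moebius_kit`) and the weight `1/(1+s²)` to
`(1/(2√(2−x(s)²))) · x'(s)`.
References: M. Kontsevich, D. Zagier, *Periods* (2001), §1.2, rule (2). No new definitions.
-/

noncomputable section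

open MeasureTheory Set
open Literature.NumberTheory.Transcendental Literature.NumberTheory.Transcendental.KZ
open Literature.ModelTheory.ExponentialFields (IsSemialgebraic)

namespace Summit.KontsevichZagierPeriods.HurwitzMicroSectors.NormalFormPrinciple.PiBox.M2

/-- Basic facts about `√2`: `(√2)² = 2` and `7/5 < √2 < 3/2`. [folklore] -/
private theorem halfAngle_sqrt_two :
    Real.sqrt 2 ^ 2 = 2 ∧ 7 / 5 < Real.sqrt 2 ∧ Real.sqrt 2 < 3 / 2 := by
  refine ⟨Real.sq_sqrt (by norm_num), ?_, ?_⟩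
  · rw [Real.lt_sqrt (by norm_num)]
    norm_num
  · rw [Real.sqrt_lt' (by norm_num)]
    norm_num

/-- The derivative of the half-angle base change `x(s) = 2√2 s/(1+s²)` is
`x'(s) = 2√2 (1 − s²)/(1 + s²)²`. [folklore] -/
private theorem halfAngle_hasDerivAt (s : ℝ) :
    HasDerivAt (fun s : ℝ => 2 * Real.sqrt 2 * s / (1 + s ^ 2))
      (2 * Real.sqrt 2 * (1 - s ^ 2) / (1 + s ^ 2) ^ 2) s := by
  have h1 : HasDerivAt (fun s : ℝ => 2 * Real.sqrt 2 * s) (2 * Real.sqrt 2) s := by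
    simpa using (hasDerivAt_id s).const_mul (2 * Real.sqrt 2)
  have h2 : HasDerivAt (fun s : ℝ => 1 + s ^ 2) (2 * s) s := by
    simpa using (hasDerivAt_pow 2 s).const_add 1
  have h0 : (1 : ℝ) + s ^ 2 ≠ 0 := by positivity
  refine (h1.div h2 h0).congr_deriv ?_
  congr 1
  ring

/-- The half-angle base change is injective as long as `a b < 1`: `x(a) = x(b)` forces
`(a − b)(1 − a b) = 0`. [folklore] -/
private theorem halfAngle_inj {a b : ℝ} (hab : a * b < 1)
    (h : 2 * Real.sqrt 2 * a / (1 + a ^ 2) = 2 * Real.sqrt 2 * b / (1 + b ^ 2)) : a = b := by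
  obtain ⟨-, hr1, -⟩ := halfAngle_sqrt_two
  rw [div_eq_div_iff (by positivity) (by positivity)] at h
  have h' : (2 * Real.sqrt 2) * ((a - b) * (1 - a * b)) = 0 := by linear_combination h
  rcases mul_eq_zero.1 h' with h'' | h''
  · linarith
  · rcases mul_eq_zero.1 h'' with h₃ | h₃
    · linarith
    · linarith

/-- For `s ∈ (0, t₈)`: `s < 1` and `0 < x(s) < 1` (`x(s) < 1 ⟺ (√2 − s)² > 1 ⟸ √2 − s > 1`).
[folklore] -/
private theorem halfAngle_mem {s : ℝ} (hs : s ∈ Ioo (0:ℝ) (Real.sqrt 2 - 1)) :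
    s < 1 ∧ 0 < 2 * Real.sqrt 2 * s / (1 + s ^ 2) ∧ 2 * Real.sqrt 2 * s / (1 + s ^ 2) < 1 := by
  obtain ⟨hr2, hr1, hr3⟩ := halfAngle_sqrt_two
  set r := Real.sqrt 2
  obtain ⟨hs0, hst⟩ := hs
  have hr0 : 0 < r := by linarith
  refine ⟨by linarith, by positivity, ?_⟩
  rw [div_lt_one (by positivity)]
  nlinarith [mul_pos (sub_pos.2 hst) (by linarith : (0:ℝ) < r - s + 1)]

/-- For `x ∈ (0,1)` the half-angle preimage `s = x/(√2 + √(2 − x²))` lies in `(0, t₈)` and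
satisfies `x(s) = x` (`tan(θ/2) = sin θ/(1 + cos θ)`). [folklore] -/
private theorem halfAngle_preimage {x : ℝ} (hx : x ∈ Ioo (0:ℝ) 1) :
    x / (Real.sqrt 2 + Real.sqrt (2 - x ^ 2)) ∈ Ioo (0:ℝ) (Real.sqrt 2 - 1) ∧
      2 * Real.sqrt 2 * (x / (Real.sqrt 2 + Real.sqrt (2 - x ^ 2))) /
        (1 + (x / (Real.sqrt 2 + Real.sqrt (2 - x ^ 2))) ^ 2) = x := by
  obtain ⟨hr2, hr1, -⟩ := halfAngle_sqrt_two
  set r := Real.sqrt 2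
  obtain ⟨hx0, hx1⟩ := hx
  have hx2 : x ^ 2 < 1 := by nlinarith
  set q := Real.sqrt (2 - x ^ 2) with hq
  have hq2 : q ^ 2 = 2 - x ^ 2 := Real.sq_sqrt (by nlinarith)
  have hq1 : 1 < q := by
    rw [hq, Real.lt_sqrt zero_le_one]
    nlinarith
  have hr0 : 0 < r := by linarith
  have hrq : 0 < r + q := by linarith
  refine ⟨⟨div_pos hx0 hrq, ?_⟩, ?_⟩
  · rw [div_lt_iff₀ hrq]
    nlinarith [mul_pos (by linarith : (0:ℝ) < r - 1) (sub_pos.2 hq1)]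
  · have hden : 1 + (x / (r + q)) ^ 2 = 2 * (2 + r * q) / (r + q) ^ 2 := by
      rw [div_pow, eq_div_iff (by positivity), add_mul, one_mul, div_mul_cancel₀ _ (by positivity)]
      linear_combination hr2 + hq2
    have h2 : (0:ℝ) < 2 * (2 + r * q) := by positivity
    have hxc : x / (r + q) * (r + q) = x := div_mul_cancel₀ x hrq.ne'
    rw [hden, div_div_eq_mul_div, div_eq_iff h2.ne']
    linear_combination (2 * r * (r + q)) * hxc + (2 * x) * hr2

/-- The image of `(0, t₈) ⊆ ℝ¹` under the half-angle base change is `(0, 1) ⊆ ℝ¹`. [folklore] -/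
private theorem halfAngle_image :
    (fun y : Fin 1 → ℝ => fun _ : Fin 1 => 2 * Real.sqrt 2 * y 0 / (1 + y 0 ^ 2)) ''
        {y : Fin 1 → ℝ | 0 < y 0 ∧ y 0 < Real.sqrt 2 - 1} =
      {y : Fin 1 → ℝ | 0 < y 0 ∧ y 0 < 1} := by
  ext y
  simp only [mem_image, mem_setOf_eq]
  constructor
  · rintro ⟨s, hs, rfl⟩
    exact (halfAngle_mem (s := s 0) hs).2
  · rintro hy
    obtain ⟨hs, hx⟩ := halfAngle_preimage (x := y 0) hy
    refine ⟨fun _ => y 0 / (Real.sqrt 2 + Real.sqrt (2 - y 0 ^ 2)), hs, ?_⟩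
    funext i
    rw [Fin.fin_one_eq_zero i]
    exact hx

/-- On `(0, t₈)` the edge transforms as `c₁(s) c₂(s) = V(x(s))`, `V(x) = (√(2−x²)+1)/(√(2−x²)−1)`
(`moebius_kit`: `√(2 − x(s)²) = √2 (1−s²)/(1+s²)` and the Möbius factorisation). [folklore] -/
private theorem halfAngle_edge {s : ℝ} (hs : s ∈ Ioo (0:ℝ) (Real.sqrt 2 - 1)) :
    ((1 - s * (Real.sqrt 2 - 1)) / (s + (Real.sqrt 2 - 1))) *
        ((1 + (Real.sqrt 2 - 1) * s) / ((Real.sqrt 2 - 1) - s)) =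
      (Real.sqrt (2 - (2 * Real.sqrt 2 * s / (1 + s ^ 2)) ^ 2) + 1) /
        (Real.sqrt (2 - (2 * Real.sqrt 2 * s / (1 + s ^ 2)) ^ 2) - 1) := by
  rw [moebius_kit.2.2.2.1 s ⟨hs.1.le, (halfAngle_mem hs).1⟩, moebius_kit.2.2.2.2 s hs]

/-- On `(0, t₈)` the weight transforms as `1/(1+s²) = (1/(2√(2 − x(s)²))) · |x'(s)|`. [folklore] -/
private theorem halfAngle_weight {s : ℝ} (hs : s ∈ Ioo (0:ℝ) (Real.sqrt 2 - 1)) :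
    1 / (1 + s ^ 2) = 1 / (2 * Real.sqrt (2 - (2 * Real.sqrt 2 * s / (1 + s ^ 2)) ^ 2)) *
      |2 * Real.sqrt 2 * (1 - s ^ 2) / (1 + s ^ 2) ^ 2| := by
  obtain ⟨-, hr1, -⟩ := halfAngle_sqrt_two
  have hs1 : s < 1 := (halfAngle_mem hs).1
  have hs0 : 0 < s := hs.1
  have h1s : 0 < 1 - s ^ 2 := by nlinarith
  have hr0 : 0 < Real.sqrt 2 := by linarith
  rw [moebius_kit.2.2.2.1 s ⟨hs.1.le, hs1⟩, abs_of_pos (by positivity)]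
  field_simp

/-- **Stub (half-angle base change, rule 2): `M_(0,t₈)(1/(1+s²), c₁c₂) ≡ M_(0,1)(1/(2√(2−x²)), V)`
along `x = 2√2 s/(1+s²)`.** For any representation `Ms` on the band
`{0 < s < t₈, 1 ≤ t ≤ c₁(s)c₂(s)}` with integrand `(1/(1+s²))/t` on it and any `J` on
`{0 < x < 1, 1 ≤ t ≤ V(x)}` with integrand `(1/(2√(2−x²)))/t` on it, `[Ms] − [J] ∈ relations`:
one instance of the change of variables
`(s, t) ↦ (x(s), t)` (`KZ.of_sub_of_mem_relations_covLift`), `x(s) = 2√2 s/(1+s²)` being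
`ℚ`-semialgebraic, differentiable (`x' = 2√2(1−s²)/(1+s²)²`), injective on `(0, t₈)` with image
`(0,1)`, with `c₁c₂ = V ∘ x` and `1/(1+s²) = (1/(2√(2−x(s)²))) · x'(s)` on `(0, t₈)`.
[cite: KontsevichZagier2001, §1.2] -/
theorem halfAngle_baseChange (Ms J : IntegralRep 2)
    (hMsd : Ms.domain = KZlog.band {y : Fin 1 → ℝ | 0 < y 0 ∧ y 0 < Real.sqrt 2 - 1} (fun _ => (1:ℝ))
      (fun y => ((1 - y 0 * (Real.sqrt 2 - 1)) / (y 0 + (Real.sqrt 2 - 1))) *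
        ((1 + (Real.sqrt 2 - 1) * y 0) / ((Real.sqrt 2 - 1) - y 0))))
    (hMsi : EqOn Ms.integrand (fun z => (1 / (1 + z 0 ^ 2)) / z 1) Ms.domain)
    (hJd : J.domain = KZlog.band {y : Fin 1 → ℝ | 0 < y 0 ∧ y 0 < 1} (fun _ => (1:ℝ))
      (fun y => (Real.sqrt (2 - y 0 ^ 2) + 1) / (Real.sqrt (2 - y 0 ^ 2) - 1)))
    (hJi : EqOn J.integrand (fun z => (1 / (2 * Real.sqrt (2 - z 0 ^ 2))) / z 1) J.domain) :
    of Ms - of J ∈ relations := by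
  obtain ⟨hr2, hr1, -⟩ := halfAngle_sqrt_two
  -- `√2` is algebraic, so the base `σ₈ = (0, t₈)` is `ℚ`-semialgebraic (algebraic endpoints)
  have hsqrt : IsAlgebraic ℚ (Real.sqrt 2) :=
    ⟨Polynomial.X ^ 2 - Polynomial.C 2, Polynomial.X_pow_sub_C_ne_zero (by norm_num) 2,
      by simp [hr2]⟩
  have hσ : IsSemialgebraic ℚ {y : Fin 1 → ℝ | 0 < y 0 ∧ y 0 < Real.sqrt 2 - 1} :=
    (isSemialgebraic_setOf_const_lt_apply isAlgebraic_zero 0).inter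
      (isSemialgebraic_setOf_apply_lt_const (hsqrt.sub isAlgebraic_one) 0)
  -- the base change and its derivative
  set Φ : (Fin 1 → ℝ) → (Fin 1 → ℝ) := fun y _ => 2 * Real.sqrt 2 * y 0 / (1 + y 0 ^ 2) with hΦ
  set Φ' : (Fin 1 → ℝ) → (Fin 1 → ℝ) →L[ℝ] (Fin 1 → ℝ) := fun y =>
    (2 * Real.sqrt 2 * (1 - y 0 ^ 2) / (1 + y 0 ^ 2) ^ 2) • ContinuousLinearMap.id ℝ (Fin 1 → ℝ)
    with hΦ'
  have hdet : ∀ y, (Φ' y).det = 2 * Real.sqrt 2 * (1 - y 0 ^ 2) / (1 + y 0 ^ 2) ^ 2 := fun y => by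
    simp [hΦ', ContinuousLinearMap.det, LinearMap.det_smul]
  have hΦd : ∀ y ∈ {y : Fin 1 → ℝ | 0 < y 0 ∧ y 0 < Real.sqrt 2 - 1},
      HasFDerivWithinAt Φ (Φ' y) {y : Fin 1 → ℝ | 0 < y 0 ∧ y 0 < Real.sqrt 2 - 1} y := by
    intro y _
    refine HasFDerivAt.hasFDerivWithinAt ?_
    rw [hasFDerivAt_pi']
    intro i
    have h1 : HasFDerivAt
        ((fun s : ℝ => 2 * Real.sqrt 2 * s / (1 + s ^ 2)) ∘ fun w : Fin 1 → ℝ => w 0)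
        ((2 * Real.sqrt 2 * (1 - y 0 ^ 2) / (1 + y 0 ^ 2) ^ 2) •
          ContinuousLinearMap.proj (R := ℝ) (φ := fun _ : Fin 1 => ℝ) 0) y :=
      (halfAngle_hasDerivAt (y 0)).comp_hasFDerivAt y (hasFDerivAt_apply 0 y)
    refine h1.congr_fderiv (ContinuousLinearMap.ext fun w => ?_)
    simp [hΦ', Fin.fin_one_eq_zero i]
  have hΦs : IsSemialgebraicMapOn ℚ {y : Fin 1 → ℝ | 0 < y 0 ∧ y 0 < Real.sqrt 2 - 1} Φ := by
    refine IsSemialgebraicMapOn.of_forall hσ fun _ => ?_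
    have hc : IsSemialgebraicFunOn ℚ {y : Fin 1 → ℝ | 0 < y 0 ∧ y 0 < Real.sqrt 2 - 1}
        (fun _ => Real.sqrt 2) := isSemialgebraicFunOn_const_of_isAlgebraic hσ hsqrt
    have hrat : IsSemialgebraicFunOn ℚ {y : Fin 1 → ℝ | 0 < y 0 ∧ y 0 < Real.sqrt 2 - 1}
        (fun y => 2 * y 0 / (1 + y 0 ^ 2)) :=
      (isSemialgebraicFunOn_aeval_div_aeval hσ (MvPolynomial.C 2 * MvPolynomial.X 0)
        (1 + MvPolynomial.X 0 ^ 2) fun y _ => by simp; positivity).congr fun y _ => by simp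
    exact (IsSemialgebraicFunOn.mul_holds hc hrat).congr fun y _ => by
      simp only [hΦ, Pi.mul_apply]
      ring
  have hΦi : InjOn Φ {y : Fin 1 → ℝ | 0 < y 0 ∧ y 0 < Real.sqrt 2 - 1} := by
    intro a ha b hb h
    have h0 : 2 * Real.sqrt 2 * a 0 / (1 + a 0 ^ 2) = 2 * Real.sqrt 2 * b 0 / (1 + b 0 ^ 2) :=
      congrFun h 0
    have hab : a 0 * b 0 < 1 := by
      have ha1 := (halfAngle_mem (s := a 0) ha).1
      have hb1 := (halfAngle_mem (s := b 0) hb).1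
      have := ha.1
      have := hb.1
      nlinarith
    funext i
    rw [Fin.fin_one_eq_zero i]
    exact halfAngle_inj hab h0
  -- one change of variables along `(s, t) ↦ (x(s), t)`
  refine of_sub_of_mem_relations_covLift hΦs hΦd hΦi
    (v := fun y => ((1 - y 0 * (Real.sqrt 2 - 1)) / (y 0 + (Real.sqrt 2 - 1))) *
      ((1 + (Real.sqrt 2 - 1) * y 0) / ((Real.sqrt 2 - 1) - y 0)))
    (v' := fun y => (Real.sqrt (2 - y 0 ^ 2) + 1) / (Real.sqrt (2 - y 0 ^ 2) - 1))
    (fun y hy => halfAngle_edge (s := y 0) hy) Ms J hMsd (by rw [hJd, hΦ, halfAngle_image])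
    fun z hz => ?_
  have hz' := hz
  rw [hMsd] at hz'
  obtain ⟨hs, h1, h2⟩ := hz'
  have hs' : z 0 ∈ Ioo (0:ℝ) (Real.sqrt 2 - 1) := hs
  have h1' : 1 ≤ z 1 := h1
  have h2' : z 1 ≤ ((1 - z 0 * (Real.sqrt 2 - 1)) / (z 0 + (Real.sqrt 2 - 1))) *
      ((1 + (Real.sqrt 2 - 1) * z 0) / ((Real.sqrt 2 - 1) - z 0)) := h2
  obtain ⟨-, hx0, hx1⟩ := halfAngle_mem hs'
  -- the coordinates of the image point, which lies in `J.domain`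
  have e0 : (Fin.snoc (Φ (Fin.init z)) (z (Fin.last 1)) : Fin 2 → ℝ) 0 =
      2 * Real.sqrt 2 * z 0 / (1 + z 0 ^ 2) := by
    simp [hΦ, Fin.snoc, Fin.init]
  have e1 : (Fin.snoc (Φ (Fin.init z)) (z (Fin.last 1)) : Fin 2 → ℝ) 1 = z 1 := by
    simp [Fin.snoc]
  have hp : (Fin.snoc (Φ (Fin.init z)) (z (Fin.last 1)) : Fin 2 → ℝ) ∈ J.domain := by
    rw [hJd]
    refine ⟨⟨?_, ?_⟩, ?_, ?_⟩
    · show 0 < (Fin.snoc (Φ (Fin.init z)) (z (Fin.last 1)) : Fin 2 → ℝ) 0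
      rwa [e0]
    · show (Fin.snoc (Φ (Fin.init z)) (z (Fin.last 1)) : Fin 2 → ℝ) 0 < 1
      rwa [e0]
    · show 1 ≤ (Fin.snoc (Φ (Fin.init z)) (z (Fin.last 1)) : Fin 2 → ℝ) 1
      rwa [e1]
    · show (Fin.snoc (Φ (Fin.init z)) (z (Fin.last 1)) : Fin 2 → ℝ) 1 ≤
        (Real.sqrt (2 - (Fin.snoc (Φ (Fin.init z)) (z (Fin.last 1)) : Fin 2 → ℝ) 0 ^ 2) + 1) /
          (Real.sqrt (2 - (Fin.snoc (Φ (Fin.init z)) (z (Fin.last 1)) : Fin 2 → ℝ) 0 ^ 2) - 1)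
      rw [e0, e1, ← halfAngle_edge hs']
      exact h2'
  rw [hMsi hz, hJi hp, hdet]
  simp only [e0, e1]
  show 1 / (1 + z 0 ^ 2) / z 1 =
    1 / (2 * Real.sqrt (2 - (2 * Real.sqrt 2 * z 0 / (1 + z 0 ^ 2)) ^ 2)) / z 1 *
      |2 * Real.sqrt 2 * (1 - z 0 ^ 2) / (1 + z 0 ^ 2) ^ 2|
  rw [div_mul_eq_mul_div, ← halfAngle_weight hs']

end Summit.KontsevichZagierPeriods.HurwitzMicroSectors.NormalFormPrinciple.PiBox.M2
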